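import Summits.HodgeConjecture.HodgeConjecture.Theorems.H413CohFormsCarriers
import Literature.NumberTheory.Automorphic.UnitaryGroupCohomologicalForms
import Summits.HodgeConjecture.HodgeConjecture.Theorems.H413SpectrumJunctionPin
import Literature.NumberTheory.Automorphic.AdelicUnitaryGroupSpectrum
import Summits.HodgeConjecture.HodgeConjecture.Theorems.F0P3HilbertProjection
import Mathlib.MeasureTheory.Function.LpSpace.ContinuousFunctions
import Mathlib.RepresentationTheory.Irreducible
import HarnessLib

/-!
# Crux `H413`, line `F0_U3CohMultOne`, stub S5 — the FORMAL `L²` SPECTRAL JUNCTION (J1′)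

Floor-0 programme P3 «U3-mult», seat F0P3-p02 (g0); crux item stmt-HodgeConjecture-24833 (`HCCMUnconditional.H413`).
HC_CM is proved only modulo the printed citations until rung 0 closes.

The engine letters E1′/E2′ (`Literature/NumberTheory/Rogawski1990/CohomologicalSpectrumInnerForm.lean`) speak about ONE
discrete automorphic representation `P ≤ L²(U(V)(F⁺)\U(V)(𝔸_{F⁺}), μ)` through the junction predicates of ★
`Literature/NumberTheory/Automorphic/UnitaryGroupCohomologicalForms.lean` §4 (`toQuotFun`, `ContainsForm`,
`IsHolCotangentAt`, `finRep`, `HasFinComponent`); the stubs S3/S4/S5 of `Cruxes/H413/Lines/F0_U3CohMultOne.lean` speak about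
`U(V)(𝔸_{F⁺,f})`-equivariant linear maps `ψ : ω_V(t) → (U(V)(𝔸_{F⁺}) → ℂ²)` valued in the (anti)holomorphic cotangent forms.
This file proves the FORMAL half of the junction between the two, with no letter and no `sorry`:

* §1 (over ★ `Theorems/H413SpectrumJunction` of F0P3-p04, any adelic group datum `𝒢`): a right translate `x ↦ Φ (x g)` of a
  left-`A_G G(K)`-invariant `Φ` descends to `q ↦ (toQuotFun Φ) (g⁻¹ • q)` (`toQuotFun_rightTranslate`), and on `L²` this is the regular
  representation: `R(g) [φ] = [φ ∘ (g⁻¹ • ·)]` for a continuous `φ` on the (compact) automorphic quotient (`rightRegular_toLp`);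
* §2 — moved to ★-pending `Theorems/F0P3HilbertProjection.lean` (generic Hilbert-space lemmas: `exists_irreducible_not_orthogonal`,
  `orthogonalProjectionOnto_map`, `isOrtho_of_ne`);
* §3 (the junction J1′, generic unitary datum `UnitaryGroup.adelicGroupData F E c N J`): if `σ` is an IRREDUCIBLE representation
  of `U(J)(𝔸_{F,f})` on `W` and `ψ : W →ₗ[ℂ] (U(J)(𝔸_F) → ℂ²)` is `G_f`-equivariant for ★ `CotangentForms.rightRep`, non-zero, with
  values left-invariant under `U(J)(F)` with CONTINUOUS coordinates `x ↦ ψ w x j` on `U(J)(𝔸_F)`, then for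
  every automorphic `μ` with `L²(μ)` discretely decomposable there is a discrete automorphic `P` which (a) is NOT ORTHOGONAL to the
  `L²`-class of some coordinate `toQuotFun (ψ w · j)` and (b) has `σ` as finite component, `P.HasFinComponent σ` — the
  intertwiner being `pr_P ∘ [·] ∘ ψ` (`exists_discreteAutomorphicRep_not_orthogonal_hasFinComponent`);
* §4 the same at the crux carriers (`adelicDatum F V`, `rightRep F V`, `cohForms 𝔞`): compactness / discrete decomposability / an
  automorphic measure from `4 ≤ [F:ℚ]`, and the junction `exists_discreteAutomorphicRep_of_equivariant_cohForms`.

* §5 (v2): J1″ `hasFinComponent_of_not_orthogonal` — the same intertwiner for EVERY discrete `P` meeting a class (no discrete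
  decomposability; the S3/S4 route with (D) + E1′ + ★ `mem_space_of_inner_eq_zero_of_ne_pin`), and `…_cohForms` at the carriers.

What is NOT here (the analytic half, a Literature letter requested from the typer on the cell bus 2026-08-30 «TP»): that a
discrete `P` not orthogonal to a holomorphic cotangent form CONTAINS a non-zero holomorphic cotangent form
(`P.IsHolCotangentAt`), i.e. that the spectral projection `pr_P` preserves the holomorphic cotangent type — Gårding
(`pr_P` commutes with `𝔭⁻` on smooth vectors) + Weyl's lemma; with it and E2′ the fold `F0P3StubS5Fold.lean` closes S5.

References: [BorelJacquet1979] Corvallis PSPM 33.1 §4.6; [Dixmier1977] *C*-algebras* §13.1; [DeitmarEchterhoff2014] Thm. 9.2.2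
(compact quotient ⇒ discrete decomposition; tree `AutomorphicSpectrumCompactQuotient`); [GelfandGraevPSh1969] Ch. 1 §2.
-/

-- the mandated namespace repeats `HodgeConjecture.HodgeConjecture`, as in every `Theorems/*.lean` of this sub-problem
set_option linter.dupNamespace false

noncomputable section

open MeasureTheory NumberField MulAction
open scoped InnerProductSpace ENNReal

namespace Summit.HodgeConjecture.HodgeConjecture.Cruxes.H413.F0P3SpectralJunction

open Literature.NumberTheory.Automorphic
open Literature.NumberTheory.Automorphic.UnitaryGroup.CotangentForms (toQuotFun toQuotFun_mk)
open Summit.HodgeConjecture.HodgeConjecture.Cruxes.H413.F0P3HilbertProjection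
open Summit.HodgeConjecture.HodgeConjecture.Cruxes.H413.SpectrumJunction

/-! ## §1 `toQuotFun` bookkeeping and the regular representation on continuous functions -/

section QuotFun

variable {K : Type} [Field K] [NumberField K] (𝒢 : AdelicGroupData.{0} K)

variable {𝒢}

/-- A left-invariant `Φ` which does not vanish identically has a non-vanishing descent. [folklore] -/
theorem toQuotFun_ne_zero {Φ : 𝒢.Adelic → ℂ} (hΦ : ∀ γ ∈ 𝒢.quotientSubgroup, ∀ g, Φ (γ * g) = Φ g) {x : 𝒢.Adelic}
    (hx : Φ x ≠ 0) : toQuotFun 𝒢 Φ (𝒢.toAutomorphicQuotient x⁻¹) ≠ 0 := by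
  rwa [toQuotFun_mk hΦ, inv_inv]

/-- **Right translation descends to the left action on the quotient**: for `Φ` left-invariant under `A_G G(K)` and any
`g ∈ G(𝔸_K)`, the descent of `x ↦ Φ (x g)` is `q ↦ (toQuotFun Φ) (g⁻¹ • q)` — the orientation matching ★ `rightRep` with ★
`AdelicGroupData.rightRegular` (`(R g f)(q) = f (g⁻¹ • q)`). [cite: BorelJacquet1979, §4.2 and §4.6] -/
theorem toQuotFun_rightTranslate {Φ : 𝒢.Adelic → ℂ} (hΦ : ∀ γ ∈ 𝒢.quotientSubgroup, ∀ g, Φ (γ * g) = Φ g)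
    (g : 𝒢.Adelic) :
    toQuotFun 𝒢 (fun x => Φ (x * g)) = fun q => toQuotFun 𝒢 Φ (g⁻¹ • q) :=
  funext fun q => toQuotFun_mul_right_apply hΦ g q

end QuotFun

section Regular

variable {K : Type} [Field K] [NumberField K] {𝒢 : AdelicGroupData.{0} K}
  {μ : Measure 𝒢.automorphicQuotient} [𝒢.IsAutomorphicMeasure μ] [CompactSpace 𝒢.automorphicQuotient]

/-- A continuous function on the compact automorphic quotient is square-integrable for the (finite) automorphic measure.
[cite: BorelJacquet1979, §4.6] -/
theorem memLp_of_continuous {φ : 𝒢.automorphicQuotient → ℂ} (hφ : Continuous φ) : MemLp φ 2 μ := by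
  let φc : C(𝒢.automorphicQuotient, ℂ) := ⟨φ, hφ⟩
  refine MemLp.of_bound hφ.aestronglyMeasurable ‖φc‖ (Filter.Eventually.of_forall fun x => ?_)
  exact φc.norm_coe_le_norm x

/-- The `L²`-class of a continuous function (Mathlib `ContinuousMap.toLp`) is its `MemLp.toLp` class. [folklore] -/
theorem toLp_eq_memLp_toLp (φ : C(𝒢.automorphicQuotient, ℂ)) (h : MemLp (φ : 𝒢.automorphicQuotient → ℂ) 2 μ) :
    ContinuousMap.toLp (E := ℂ) 2 μ ℂ φ = h.toLp := by
  apply Lp.ext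
  exact (ContinuousMap.coeFn_toLp (E := ℂ) (p := (2 : ℝ≥0∞)) (𝕜 := ℂ) μ φ).trans (MemLp.coeFn_toLp h).symm

/-- **The regular representation on classes of continuous functions**: `R(g) [φ] = [φ ∘ (g⁻¹ • ·)]` (★ `rightRegular_apply_coeFn`
and the invariance of `μ`). [cite: BorelJacquet1979, §4.6] -/
theorem rightRegular_toLp (g : 𝒢.Adelic) (φ : C(𝒢.automorphicQuotient, ℂ)) :
    𝒢.rightRegular μ g (ContinuousMap.toLp (E := ℂ) 2 μ ℂ φ) =
      ContinuousMap.toLp (E := ℂ) 2 μ ℂ (φ.comp ⟨fun q => g⁻¹ • q, continuous_const_smul g⁻¹⟩) := by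
  apply Lp.ext
  refine (𝒢.rightRegular_apply_coeFn μ g _).trans ?_
  refine Filter.EventuallyEq.trans ?_ (ContinuousMap.coeFn_toLp (E := ℂ) (p := (2 : ℝ≥0∞)) (𝕜 := ℂ) μ _).symm
  -- pull the a.e. identity `[φ] = φ` back along the measure-preserving map `q ↦ g⁻¹ • q`
  have hmp : MeasurePreserving (fun q : 𝒢.automorphicQuotient => g⁻¹ • q) μ μ := measurePreserving_smul g⁻¹ μ
  exact hmp.quasiMeasurePreserving.ae_eq_comp (ContinuousMap.coeFn_toLp (E := ℂ) (p := (2 : ℝ≥0∞)) (𝕜 := ℂ) μ φ)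

end Regular

/-! ## §3 The junction J1′ for a unitary group `U(J)` (generic datum `UnitaryGroup.adelicGroupData F E c N J`) -/

section Junction

open Literature.NumberTheory.Automorphic.UnitaryGroup
open Literature.NumberTheory.Automorphic.UnitaryGroup.CotangentForms (rightRep)

variable {F E : Type} [Field F] [NumberField F] [Field E] [NumberField E] [Algebra F E]
  {c : E ≃ₐ[F] E} {N : ℕ} {J : Matrix (Fin N) (Fin N) E}
  {μ : Measure (adelicGroupData F E c N J).automorphicQuotient} [(adelicGroupData F E c N J).IsAutomorphicMeasure μ]
  [CompactSpace (adelicGroupData F E c N J).automorphicQuotient]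

/-- **J1′ — THE FORMAL `L²` SPECTRAL JUNCTION.**  Let `μ` be an automorphic measure on the COMPACT quotient
`U(J)(F)\U(J)(𝔸_F)` with `L²(μ)` discretely decomposable (★ `UnitaryGroup.isDiscretelyDecomposable_rightRegular_adelicGroupData`
for anisotropic `J`), `σ` an IRREDUCIBLE representation of `U(J)(𝔸_{F,f})` on `W`, and `ψ : W →ₗ[ℂ] (U(J)(𝔸_F) → ℂ²)` a NON-ZERO
linear map, `G_f`-equivariant for right translation (★ `CotangentForms.rightRep`), whose values are left-`U(J)(F)`-invariant with
CONTINUOUS coordinates `x ↦ ψ w x j` on `U(J)(𝔸_F)` (hence continuous descents `toQuotFun (ψ w · j)` to the quotient).  Then there is a discrete automorphic representation `P ≤ L²(μ)`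
(irreducible closed invariant subspace) which is NOT ORTHOGONAL to the `L²`-class of some coordinate `toQuotFun (ψ w · j)`, and in
which `σ` OCCURS: `P.HasFinComponent σ` — the injective `G_f`-intertwiner `σ → P|_{G_f}` being `pr_P ∘ [·]_j ∘ ψ` (orthogonal
projection of the class; it commutes with `G(𝔸)` and is non-zero on `w`, hence injective by irreducibility).
[cite: BorelJacquet1979, §4.6] [cite: Dixmier1977, §13.1] -/
theorem exists_discreteAutomorphicRep_not_orthogonal_hasFinComponent
    (hdisc : ((adelicGroupData F E c N J).rightRegular μ).IsDiscretelyDecomposable)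
    {W : Type} [AddCommGroup W] [Module ℂ W] (σ : Representation ℂ (finAdelic F E c N J) W) (hσ : σ.IsIrreducible)
    (ψ : W →ₗ[ℂ] ((adelicGroupData F E c N J).Adelic → (Fin 2 → ℂ)))
    (heqv : ∀ (g : finAdelic F E c N J) (w : W), ψ (σ g w) = rightRep F E c N J g (ψ w))
    (hinv : ∀ (w : W), ∀ γ ∈ (adelicGroupData F E c N J).quotientSubgroup, ∀ x, ψ w (γ * x) = ψ w x)
    (hcont : ∀ (w : W) (j : Fin 2), Continuous fun x => ψ w x j)
    (hψ : ψ ≠ 0) :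
    ∃ (P : DiscreteAutomorphicRep (adelicGroupData F E c N J) μ) (w : W) (j : Fin 2)
      (h : MemLp (toQuotFun (adelicGroupData F E c N J) fun x => ψ w x j) 2 μ),
      (∃ u ∈ P.space, ⟪(u : (adelicGroupData F E c N J).L2 μ), h.toLp⟫_ℂ ≠ 0) ∧ P.HasFinComponent σ := by
  haveI := hσ
  -- a non-zero value of `ψ`
  obtain ⟨w₀, hw₀⟩ : ∃ w, ψ w ≠ 0 := by
    by_contra h
    push Not at h
    exact hψ (LinearMap.ext h)
  obtain ⟨x₀, j₀, hx₀⟩ : ∃ x j, ψ w₀ x j ≠ 0 := by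
    by_contra h
    push Not at h
    exact hw₀ (funext fun x => funext fun j => h x j)
  -- left invariance of the coordinates
  have hinv' : ∀ (w : W) (j : Fin 2), ∀ γ ∈ (adelicGroupData F E c N J).quotientSubgroup, ∀ x,
      (fun x => ψ w x j) (γ * x) = (fun x => ψ w x j) x := fun w j γ hγ x => by
    simp only [hinv w γ hγ x]
  -- continuity of the descended coordinates
  have hcont' : ∀ (w : W) (j : Fin 2), Continuous (toQuotFun (adelicGroupData F E c N J) fun x => ψ w x j) :=
    fun w j => continuous_toQuotFun (hinv' w j) (hcont w j)
  -- the class map of the coordinate `j₀`: `w ↦ [toQuotFun (ψ w · j₀)] ∈ L²(μ)`, linear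
  let φ : W → C((adelicGroupData F E c N J).automorphicQuotient, ℂ) := fun w =>
    ⟨toQuotFun (adelicGroupData F E c N J) fun x => ψ w x j₀, hcont' w j₀⟩
  have hφ_add : ∀ w w', φ (w + w') = φ w + φ w' := fun w w' => by
    ext q
    simp only [φ, map_add, ContinuousMap.coe_mk, ContinuousMap.add_apply, toQuotFun, Pi.add_apply]
  have hφ_smul : ∀ (r : ℂ) (w : W), φ (r • w) = r • φ w := fun r w => by
    ext q
    simp only [φ, map_smul, ContinuousMap.coe_mk, ContinuousMap.smul_apply, toQuotFun, Pi.smul_apply]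
  let cl : W →ₗ[ℂ] (adelicGroupData F E c N J).L2 μ :=
    { toFun := fun w => ContinuousMap.toLp (E := ℂ) 2 μ ℂ (φ w)
      map_add' := fun w w' => by simp only [hφ_add, map_add]
      map_smul' := fun r w => by simp only [hφ_smul, map_smul, RingHom.id_apply] }
  have hcl_apply : ∀ w, cl w = ContinuousMap.toLp (E := ℂ) 2 μ ℂ (φ w) := fun w => rfl
  -- it is non-zero at `w₀`
  have hcl0 : cl w₀ ≠ 0 := by
    intro h0
    have h1 : φ w₀ = 0 := ContinuousMap.toLp_injective (E := ℂ) (p := (2 : ℝ≥0∞)) (𝕜 := ℂ) μ (by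
      rw [map_zero]; exact h0)
    have h2 := congrArg (fun f : C((adelicGroupData F E c N J).automorphicQuotient, ℂ) =>
      f ((adelicGroupData F E c N J).toAutomorphicQuotient x₀⁻¹)) h1
    simp only [φ, ContinuousMap.coe_mk, ContinuousMap.zero_apply] at h2
    exact toQuotFun_ne_zero (hinv' w₀ j₀) hx₀ h2
  -- and it intertwines right translation with the regular representation
  have hcl_eqv : ∀ (g : finAdelic F E c N J) (w : W),
      cl (σ g w) = (adelicGroupData F E c N J).rightRegular μ (finAdelicToAdelic F E c N J g) (cl w) := by
    intro g w
    rw [hcl_apply, hcl_apply, rightRegular_toLp]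
    congr 1
    ext q
    have key := congrFun (toQuotFun_rightTranslate (𝒢 := adelicGroupData F E c N J) (Φ := fun y => ψ w y j₀)
      (hinv' w j₀) (finAdelicToAdelic F E c N J g)) q
    simp only [φ, heqv, ContinuousMap.coe_mk, ContinuousMap.comp_apply, CotangentForms.rightRep_apply]
    exact key
  -- an irreducible summand not orthogonal to `cl w₀`
  obtain ⟨Wc, hWirr, hu⟩ := exists_irreducible_not_orthogonal hdisc hcl0
  let P : DiscreteAutomorphicRep (adelicGroupData F E c N J) μ := ⟨Wc, hWirr⟩
  refine ⟨P, w₀, j₀, memLp_of_continuous (hcont' w₀ j₀), ?_, ?_⟩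
  · have hcl : MemLp.toLp (toQuotFun (adelicGroupData F E c N J) fun x => ψ w₀ x j₀)
        (memLp_of_continuous (hcont' w₀ j₀)) = cl w₀ :=
      (toLp_eq_memLp_toLp (μ := μ) (φ w₀) (memLp_of_continuous (hcont' w₀ j₀))).symm
    rw [hcl]
    exact hu
  · -- the intertwiner `pr_P ∘ cl`
    let f : W →ₗ[ℂ] Wc.toSubmodule := (Wc.toSubmodule.orthogonalProjectionOnto).toLinearMap ∘ₗ cl
    have hf_apply : ∀ w, f w = Wc.toSubmodule.orthogonalProjectionOnto (cl w) := fun w => rfl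
    have hf_eqv : ∀ (g : finAdelic F E c N J) (w : W), f (σ g w) = P.finRep g (f w) := by
      intro g w
      apply Subtype.ext
      rw [hf_apply, hf_apply, hcl_eqv,
        orthogonalProjectionOnto_map ((adelicGroupData F E c N J).isUnitary_rightRegular μ)]
      rfl
    have hf0 : f w₀ ≠ 0 := by
      rw [hf_apply]
      exact orthogonalProjectionOnto_ne_zero Wc hu
    let fI : σ.IntertwiningMap P.finRep := f.intertwiningMap_of_isIntertwiningMap σ P.finRep hf_eqv
    refine ⟨fI, ?_⟩
    rcases Representation.IsIrreducible.injective_or_eq_zero fI with h | h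
    · exact h
    · exfalso
      apply hf0
      have h3 : fI w₀ = 0 := by rw [h]; rfl
      exact h3

end Junction

/-! ## §4 At the crux carriers: `U(V)` for a hermitian 3-space `V` over a CM field (`adelicDatum F V`, `rightRep F V`, `cohForms 𝔞`) -/

section Carriers

open Summit.HodgeConjecture.HodgeConjecture.Cruxes.H413.CohFormsCarriers

variable (F : HodgeCM.CMField) {ι₁ : F →+* ℂ} (V : HodgeCM.HermSpace3 F ι₁)

variable {F V}

/-- Coordinates of cohomological cotangent forms are left-invariant under `A_G · U(V)(F⁺)`. [cite: BorelWallach2000, VII 2.10] -/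
theorem cohForms_left_invariant_apply (𝔞 : ArchFactor F V) {f : (adelicDatum F V).Adelic → (Fin 2 → ℂ)}
    (hf : f ∈ cohForms 𝔞) (j : Fin 2) : ∀ γ ∈ (adelicDatum F V).quotientSubgroup, ∀ x, (fun x => f x j) (γ * x) = (fun x => f x j) x :=
  fun γ hγ x => by simp only [leftInvariant_of_mem_cohForms_pin hf γ hγ x]

/-- `Hm V` is anisotropic once `[F:ℚ] ≥ 4` (it is positive definite at a second complex place). [folklore] -/
theorem anisotropic_Hm (h4 : 4 ≤ Module.finrank ℚ F) :
    ∀ x : Fin 3 → HodgeCM.CMField.K F, Literature.AlgebraicGeometry.ShimuraVarieties.hermForm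
      (cmConjRingHom (HodgeCM.CMField.K F)) (HodgeCM.HermSpace3.Hm V) x x = 0 → x = 0 := by
  obtain ⟨τ, hτ⟩ := UnitaryGroup.exists_infinitePlace_ne (HodgeCM.CMField.K F) h4 ι₁
  exact UnitaryGroup.anisotropic_of_posDef_map (HodgeCM.CMField.K F) (HodgeCM.HermSpace3.Hm V) τ (V.posDef_of_ne τ hτ)

/-- An automorphic measure on `U(V)(F⁺)\U(V)(𝔸_{F⁺})` EXISTS once `[F:ℚ] ≥ 4` (★
`UnitaryGroup.exists_isAutomorphicMeasure_isDiscretelyDecomposable_adelicGroupData`). [cite: Borel1963, §5] -/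
theorem exists_isAutomorphicMeasure (h4 : 4 ≤ Module.finrank ℚ F) :
    ∃ (μ : Measure (adelicDatum F V).automorphicQuotient), (adelicDatum F V).IsAutomorphicMeasure μ := by
  obtain ⟨μ, hμ, _⟩ := UnitaryGroup.exists_isAutomorphicMeasure_isDiscretelyDecomposable_adelicGroupData
    (HodgeCM.CMField.K F) 3 (HodgeCM.HermSpace3.Hm V) (anisotropic_Hm h4)
  exact ⟨μ, hμ⟩

/-- **J1′ AT THE CARRIERS.**  `[F:ℚ] ≥ 4`, `μ` automorphic on `U(V)(F⁺)\U(V)(𝔸_{F⁺})`, `𝔞` any archimedean factor, the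
cohomological cotangent forms of `𝔞` being CONTINUOUS on `U(V)(𝔸_{F⁺})` (the content of P2's registered stub U2ℓ
`StubU2lL2Realisation` via `continuous_of_continuous_descent`; the hypothesis shape of ★-pending `Theorems/H413SpectrumJunction`); `σ` irreducible on `W`, `ψ : W →ₗ (U(V)(𝔸_{F⁺}) → ℂ²)` non-zero, `U(V)(𝔸_{F⁺,f})`-equivariant
(`rightRep F V`) with values in `cohForms 𝔞`.  Then some discrete automorphic `P ≤ L²(μ)` is not orthogonal to the class of a
coordinate `toQuotFun (ψ w · j)` and has finite component `σ` (`P.HasFinComponent σ`). [cite: BorelJacquet1979, §4.6] -/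
theorem exists_discreteAutomorphicRep_of_equivariant_cohForms (h4 : 4 ≤ Module.finrank ℚ F)
    (μ : Measure (adelicDatum F V).automorphicQuotient) [(adelicDatum F V).IsAutomorphicMeasure μ] (𝔞 : ArchFactor F V)
    (hcont : ∀ f ∈ cohForms 𝔞, ∀ j : Fin 2, Continuous fun x => f x j)
    {W : Type} [AddCommGroup W] [Module ℂ W] (σ : Representation ℂ ↥(HodgeCM.HermSpace3.adelicFin V) W)
    (hσ : σ.IsIrreducible) (ψ : W →ₗ[ℂ] ((adelicDatum F V).Adelic → (Fin 2 → ℂ)))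
    (heqv : ∀ (g : ↥(HodgeCM.HermSpace3.adelicFin V)) (w : W), ψ (σ g w) = rightRep F V g (ψ w))
    (hval : ∀ w, ψ w ∈ cohForms 𝔞) (hψ : ψ ≠ 0) :
    ∃ (P : DiscreteAutomorphicRep (adelicDatum F V) μ) (w : W) (j : Fin 2)
      (h : MemLp (toQuotFun (adelicDatum F V) fun x => ψ w x j) 2 μ),
      (∃ u ∈ P.space, ⟪(u : (adelicDatum F V).L2 μ), h.toLp⟫_ℂ ≠ 0) ∧ P.HasFinComponent σ := by
  haveI := compactSpace_automorphicQuotient_adelicDatum F V h4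
  exact exists_discreteAutomorphicRep_not_orthogonal_hasFinComponent
    (UnitaryGroup.isDiscretelyDecomposable_rightRegular_adelicGroupData (HodgeCM.CMField.K F) 3 (HodgeCM.HermSpace3.Hm V)
      (anisotropic_Hm h4) μ) σ hσ ψ
    heqv (fun w => leftInvariant_of_mem_cohForms_pin (hval w)) (fun w j => hcont (ψ w) (hval w) j) hψ

end Carriers


/-! ## §5 (v2, appended) The projection-route intertwiner for EVERY discrete `P` meeting a class (the S3/S4 folds' form) -/

section Every

open Literature.NumberTheory.Automorphic.UnitaryGroup
open Literature.NumberTheory.Automorphic.UnitaryGroup.CotangentForms (rightRep)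

variable {F E : Type} [Field F] [NumberField F] [Field E] [NumberField E] [Algebra F E]
  {c : E ≃ₐ[F] E} {N : ℕ} {J : Matrix (Fin N) (Fin N) E}
  {μ : Measure (adelicGroupData F E c N J).automorphicQuotient} [(adelicGroupData F E c N J).IsAutomorphicMeasure μ]
  [CompactSpace (adelicGroupData F E c N J).automorphicQuotient]

/-- **J1″ — EVERY discrete `P` that meets the class of a coordinate of `ψ w` has finite component `σ`.**  Same data as J1′
(`exists_discreteAutomorphicRep_not_orthogonal_hasFinComponent`) but for a GIVEN discrete automorphic `P` with
`∃ u ∈ P.space, ⟪u, [toQuotFun (ψ w · j)]⟫ ≠ 0`: the intertwiner `pr_P ∘ [·]_j ∘ ψ : σ → P|_{G_f}` is non-zero at `w`, hence injective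
(`σ` irreducible), so `P.HasFinComponent σ`; no discrete decomposability is used.  With the detection letter (D) such a `P` is moreover of the
Hodge type of `ψ`'s values, and with E1′ it is THE `P` of that type — whence, by ★ `mem_space_of_inner_eq_zero_of_ne_pin`, `[ψ w]_j ∈ P.space`
(the S3/S4 route). [cite: BorelJacquet1979, §4.6] [cite: Dixmier1977, §13.1] -/
theorem hasFinComponent_of_not_orthogonal (P : DiscreteAutomorphicRep (adelicGroupData F E c N J) μ)
    {W : Type} [AddCommGroup W] [Module ℂ W] (σ : Representation ℂ (finAdelic F E c N J) W) (hσ : σ.IsIrreducible)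
    (ψ : W →ₗ[ℂ] ((adelicGroupData F E c N J).Adelic → (Fin 2 → ℂ)))
    (heqv : ∀ (g : finAdelic F E c N J) (w : W), ψ (σ g w) = rightRep F E c N J g (ψ w))
    (hinv : ∀ (w : W), ∀ γ ∈ (adelicGroupData F E c N J).quotientSubgroup, ∀ x, ψ w (γ * x) = ψ w x)
    (hcont : ∀ (w : W) (j : Fin 2), Continuous fun x => ψ w x j)
    {w₀ : W} {j₀ : Fin 2} (h : MemLp (toQuotFun (adelicGroupData F E c N J) fun x => ψ w₀ x j₀) 2 μ)
    (hu : ∃ u ∈ P.space, ⟪(u : (adelicGroupData F E c N J).L2 μ), h.toLp⟫_ℂ ≠ 0) :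
    P.HasFinComponent σ := by
  haveI := hσ
  have hinv' : ∀ (w : W) (j : Fin 2), ∀ γ ∈ (adelicGroupData F E c N J).quotientSubgroup, ∀ x,
      (fun x => ψ w x j) (γ * x) = (fun x => ψ w x j) x := fun w j γ hγ x => by
    simp only [hinv w γ hγ x]
  have hcont' : ∀ (w : W) (j : Fin 2), Continuous (toQuotFun (adelicGroupData F E c N J) fun x => ψ w x j) :=
    fun w j => continuous_toQuotFun (hinv' w j) (hcont w j)
  -- the class map of the coordinate `j₀`
  let φ : W → C((adelicGroupData F E c N J).automorphicQuotient, ℂ) := fun w =>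
    ⟨toQuotFun (adelicGroupData F E c N J) fun x => ψ w x j₀, hcont' w j₀⟩
  have hφ_add : ∀ w w', φ (w + w') = φ w + φ w' := fun w w' => by
    ext q
    simp only [φ, map_add, ContinuousMap.coe_mk, ContinuousMap.add_apply, toQuotFun, Pi.add_apply]
  have hφ_smul : ∀ (r : ℂ) (w : W), φ (r • w) = r • φ w := fun r w => by
    ext q
    simp only [φ, map_smul, ContinuousMap.coe_mk, ContinuousMap.smul_apply, toQuotFun, Pi.smul_apply]
  let cl : W →ₗ[ℂ] (adelicGroupData F E c N J).L2 μ :=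
    { toFun := fun w => ContinuousMap.toLp (E := ℂ) 2 μ ℂ (φ w)
      map_add' := fun w w' => by simp only [hφ_add, map_add]
      map_smul' := fun r w => by simp only [hφ_smul, map_smul, RingHom.id_apply] }
  have hcl_apply : ∀ w, cl w = ContinuousMap.toLp (E := ℂ) 2 μ ℂ (φ w) := fun w => rfl
  have hcl_eqv : ∀ (g : finAdelic F E c N J) (w : W),
      cl (σ g w) = (adelicGroupData F E c N J).rightRegular μ (finAdelicToAdelic F E c N J g) (cl w) := by
    intro g w
    rw [hcl_apply, hcl_apply, rightRegular_toLp]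
    congr 1
    ext q
    have key := congrFun (toQuotFun_rightTranslate (𝒢 := adelicGroupData F E c N J) (Φ := fun y => ψ w y j₀)
      (hinv' w j₀) (finAdelicToAdelic F E c N J g)) q
    simp only [φ, heqv, ContinuousMap.coe_mk, ContinuousMap.comp_apply, CotangentForms.rightRep_apply]
    exact key
  -- the given class is `cl w₀`
  have hcl₀ : h.toLp = cl w₀ := (toLp_eq_memLp_toLp (μ := μ) (φ w₀) h).symm
  rw [hcl₀] at hu
  -- the intertwiner `pr_P ∘ cl`
  let f : W →ₗ[ℂ] P.space.toSubmodule := (P.space.toSubmodule.orthogonalProjectionOnto).toLinearMap ∘ₗ cl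
  have hf_apply : ∀ w, f w = P.space.toSubmodule.orthogonalProjectionOnto (cl w) := fun w => rfl
  have hf_eqv : ∀ (g : finAdelic F E c N J) (w : W), f (σ g w) = P.finRep g (f w) := by
    intro g w
    apply Subtype.ext
    rw [hf_apply, hf_apply, hcl_eqv,
      orthogonalProjectionOnto_map ((adelicGroupData F E c N J).isUnitary_rightRegular μ)]
    rfl
  have hf0 : f w₀ ≠ 0 := by
    rw [hf_apply]
    exact orthogonalProjectionOnto_ne_zero P.space hu
  let fI : σ.IntertwiningMap P.finRep := f.intertwiningMap_of_isIntertwiningMap σ P.finRep hf_eqv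
  refine ⟨fI, ?_⟩
  rcases Representation.IsIrreducible.injective_or_eq_zero fI with hinj | hzero
  · exact hinj
  · exfalso
    apply hf0
    have h3 : fI w₀ = 0 := by rw [hzero]; rfl
    exact h3

end Every

section EveryCarriers

open Summit.HodgeConjecture.HodgeConjecture.Cruxes.H413.CohFormsCarriers

variable {F : HodgeCM.CMField} {ι₁ : F →+* ℂ} {V : HodgeCM.HermSpace3 F ι₁}

/-- **J1″ AT THE CARRIERS**: `[F:ℚ] ≥ 4`, `μ` automorphic, `𝔞` any archimedean factor with continuous cohomological cotangent forms; `σ` irreducible,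
`ψ` `U(V)(𝔸_{F⁺,f})`-equivariant (`rightRep F V`) valued in `cohForms 𝔞`; then EVERY discrete `P ≤ L²(μ)` meeting the class of a coordinate of
some `ψ w` has `P.HasFinComponent σ`. [cite: BorelJacquet1979, §4.6] -/
theorem hasFinComponent_of_not_orthogonal_cohForms (h4 : 4 ≤ Module.finrank ℚ F)
    {μ : Measure (adelicDatum F V).automorphicQuotient} [(adelicDatum F V).IsAutomorphicMeasure μ] (𝔞 : ArchFactor F V)
    (hcont : ∀ f ∈ cohForms 𝔞, ∀ j : Fin 2, Continuous fun x => f x j)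
    (P : DiscreteAutomorphicRep (adelicDatum F V) μ)
    {W : Type} [AddCommGroup W] [Module ℂ W] (σ : Representation ℂ ↥(HodgeCM.HermSpace3.adelicFin V) W)
    (hσ : σ.IsIrreducible) (ψ : W →ₗ[ℂ] ((adelicDatum F V).Adelic → (Fin 2 → ℂ)))
    (heqv : ∀ (g : ↥(HodgeCM.HermSpace3.adelicFin V)) (w : W), ψ (σ g w) = rightRep F V g (ψ w))
    (hval : ∀ w, ψ w ∈ cohForms 𝔞)
    {w₀ : W} {j₀ : Fin 2} (h : MemLp (toQuotFun (adelicDatum F V) fun x => ψ w₀ x j₀) 2 μ)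
    (hu : ∃ u ∈ P.space, ⟪(u : (adelicDatum F V).L2 μ), h.toLp⟫_ℂ ≠ 0) :
    P.HasFinComponent σ := by
  haveI := compactSpace_automorphicQuotient_adelicDatum F V h4
  exact hasFinComponent_of_not_orthogonal P σ hσ ψ heqv (fun w => leftInvariant_of_mem_cohForms_pin (hval w))
    (fun w j => hcont (ψ w) (hval w) j) h hu

end EveryCarriers

end Summit.HodgeConjecture.HodgeConjecture.Cruxes.H413.F0P3SpectralJunction

end
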